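import Mathlib
import Summits.Ventures.DiscreteObjects.Mahler.FourTermCoprimeSharp
import Summits.Ventures.DiscreteObjects.Mahler.FourTermResidualCerts
import Summits.Ventures.DiscreteObjects.Mahler.TrinomialSmythBound
import Summits.Ventures.DiscreteObjects.Mahler.LowDegreeMeasures
import Summits.Ventures.DiscreteObjects.Mahler.SubLehmerStructure
import Literature.NumberTheory.MahlerMeasure.FewMonomials

/-!
# Dobrowolski's Proposition 2 in the kernel: a quadrinomial has `M = 1` or `M ≥ θ₀` (venture `DiscreteObjects`, target L)

Cell `pub-namedobj`, seat `pub-namedobj-mahler-g24`. Framing: lottery ticket; floor = certified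
bounds/negative ranges.

**Theorem** (`smythTheta_le_measure_of_card_support_le_four`; REPLICATION of [Dobrowolski2006] E. Dobrowolski,
Acta Arith. 123 (2006) 201–231, Proposition 2, with the trivial reductions): every `P ∈ ℤ[X]` with at most
four nonzero coefficients and `M(P) > 1` has `M(P) ≥ θ₀ = M(x³ - x - 1) = 1.3247…` (sharp).  As a corollary the
Literature named fact `QuadrinomialMahlerBound` is DISCHARGED (`quadrinomialMahlerBound_holds`).

Proof = the paper's: reduce to the monic reciprocal quadrinomial `R = x^{p+q} + b x^p + s b x^q + s` with
`gcd(p, q) = 1` (`P₀ = ±R(x^g)`); then the resultant bounds of `FourTermMeasureBound` /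
`FourTermCyclotomicFactors` / `FourTermAbsTwoFactors` / `FourTermSpecialFamily` with the cyclotomic parts
bounded sharply thanks to `gcd = 1` (`FourTermCoprimeSharp`), and the residual finite set —
degree `≤ 5` by `LowDegreeMeasures` (kernel census), `|b| = 2` with `6 ≤ p + q ≤ 26` and `(1,5,±3)`, `(3,5,±4)`
by the Graeffe certificates of `FourTermResidualCerts` (the paper: "checked by direct computation of `M(f)`").

* `smythTheta_le_measure_quadrinomial_coprime`, `smythTheta_le_measure_quadrinomial`;
* `smythTheta_le_measure_of_card_support_le_four`, `measure_dichotomy_of_card_support_le_four`;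
* `intMahlerMeasure_quadrinomial_sharp` (`x⁴ - x³ - x² + 1`: four monomials, `M = θ₀`);
* `quadrinomialMahlerBound_holds`.
-/

namespace Summit.Ventures.DiscreteObjects.Mahler

open Polynomial

section Quadrinomial

variable {p q : ℕ} {b s : ℤ}

/-- **The coprime quadrinomial.**  `R = x^{p+q} + b x^p + s b x^q + s` with `0 < p < q`, `gcd(p,q) = 1`, `s = ±1`,
`b ≠ 0` and `M(R) > 1` has `M(R) ≥ θ₀`. -/
theorem smythTheta_le_measure_quadrinomial_coprime (hp : 0 < p) (hpq : p < q) (hcop : Nat.Coprime p q)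
    (hs : s = 1 ∨ s = -1) (hb0 : b ≠ 0)
    (hM : 1 < intMahlerMeasure (X ^ (p + q) + C b * X ^ p + C (s * b) * X ^ q + C s : ℤ[X])) :
    smythTheta ≤ intMahlerMeasure (X ^ (p + q) + C b * X ^ p + C (s * b) * X ^ q + C s : ℤ[X]) := by
  obtain ⟨hmon, hdeg⟩ := quadrinomial_monic_natDegree hp hpq b s
  set P : ℤ[X] := X ^ (p + q) + C b * X ^ p + C (s * b) * X ^ q + C s with hP
  set n := p + q with hn
  have hθ : smythTheta < 13248 / 10000 := smythTheta_lt
  -- degree `≤ 5`: the low-degree kernel census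
  by_cases hn5 : n ≤ 5
  · exact not_measure_lt_smythTheta_of_natDegree_le_five (by rw [hdeg]; exact hn5) hM
  have hn6 : 6 ≤ n := by omega
  -- `|b| = 1`: `R = (x^p + sb)(x^q + b)` has measure `1`
  by_cases hb1 : |b| = 1
  · exfalso
    have hbs : b = 1 ∨ b = -1 := by rcases abs_choice b with h | h <;> rw [h] at hb1 <;> omega
    have hbb : b * b = 1 := by rcases hbs with h | h <;> simp [h]
    have hfac : P = (X ^ p + C (s * b)) * (X ^ q + C b) := by
      have hCb : (C b : ℤ[X]) * C b = 1 := by rw [← map_mul, hbb, map_one]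
      rw [hP, map_mul, pow_add]; linear_combination (-(C s : ℤ[X])) * hCb
    have hsb : s * b = 1 ∨ s * b = -1 := by rcases hs with h | h <;> rcases hbs with h' | h' <;> simp [h, h']
    rw [hfac, intMahlerMeasure_mul, intMahlerMeasure_X_pow_add_sign hsb hp,
      intMahlerMeasure_X_pow_add_sign hbs (by omega), mul_one] at hM
    exact lt_irrefl _ hM
  have hb2 : 2 ≤ |b| := by have := abs_pos.mpr hb0; omega
  by_cases hb2' : |b| = 2
  · -- `|b| = 2`: certificates for `6 ≤ n ≤ 26`, the long case beyond
    have hbb : b = 2 ∨ b = -2 := by rcases abs_choice b with h | h <;> rw [h] at hb2' <;> omega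
    by_cases hn26 : n ≤ 26
    · exact le_of_lt (lt_trans hθ (lt_measure_residual_two hp hpq hcop hn6 hn26 hbb hs))
    · exact smythTheta_le_measure_quadrinomial_two hp hpq hcop hs hbb (by omega)
  have hb3 : 3 ≤ |b| := by omega
  by_cases hfam : p + q = b.natAbs * (q - p)
  · -- the special family: `|b| = 3` is impossible for coprime exponents, `|b| = 4` is `(3, 5)`, `|b| ≥ 5`
    have hB : (b.natAbs : ℤ) = |b| := Int.natCast_natAbs b
    by_cases hb4 : |b| ≤ 4
    · have hb34 : b.natAbs = 3 ∨ b.natAbs = 4 := by omega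
      rcases hb34 with h3 | h4
      · exfalso
        rw [h3] at hfam
        have : q = 2 * p := by omega
        have : Nat.gcd p q = p := by rw [this]; exact Nat.gcd_eq_left ⟨2, by ring⟩
        rw [Nat.Coprime] at hcop; omega
      · rw [h4] at hfam
        have hp3 : p = 3 := by
          have h1 : p ∣ 3 * q := ⟨5, by omega⟩
          have h2 : p ∣ 3 := hcop.dvd_of_dvd_mul_right h1
          have h3' : 3 ∣ 5 * p := ⟨q, by omega⟩
          have h4' : 3 ∣ p := (Nat.Coprime.dvd_of_dvd_mul_left (by norm_num) h3')
          exact Nat.dvd_antisymm h2 h4'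
        have hq5 : q = 5 := by omega
        subst hp3; subst hq5
        have hb44 : b = 4 ∨ b = -4 := by rcases abs_choice b with h | h <;> rw [h] at hb4 hb3 <;> omega
        exact le_of_lt (lt_trans hθ ((lt_measure_residual_extra (b := b) hs).2 hb44))
    · exact smythTheta_le_measure_quadrinomial_special hp hpq hs (by omega) hfam
  · -- generic: `|b| = 3`, `n = 6` is `(1, 5)` (certificate); otherwise the generic bound
    by_cases h36 : |b| = 3 ∧ n = 6
    · obtain ⟨h3, hn6'⟩ := h36
      have hp1 : p = 1 := by
        have hq : q = 6 - p := by omega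
        have hlt : p < 3 := by omega
        interval_cases p
        · rfl
        · exfalso; rw [hq] at hcop; norm_num at hcop
      have hq5 : q = 5 := by omega
      subst hp1; subst hq5
      have hb33 : b = 3 ∨ b = -3 := by rcases abs_choice b with h | h <;> rw [h] at h3 <;> omega
      exact le_of_lt (lt_trans hθ ((lt_measure_residual_extra (b := b) hs).1 hb33))
    · exact smythTheta_le_measure_quadrinomial_generic hp hpq hcop hs hb3 hfam hn6
        (fun h3 h6 => h36 ⟨h3, h6⟩)

/-- **Any reciprocal quadrinomial** `x^{p+q} + b x^p + s b x^q + s` (`0 < p < q`, `s = ±1`, `b ≠ 0`) with `M > 1`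
has `M ≥ θ₀`: reduce to `gcd(p, q) = 1` through `P = R(x^g)`. -/
theorem smythTheta_le_measure_quadrinomial (hp : 0 < p) (hpq : p < q) (hs : s = 1 ∨ s = -1) (hb0 : b ≠ 0)
    (hM : 1 < intMahlerMeasure (X ^ (p + q) + C b * X ^ p + C (s * b) * X ^ q + C s : ℤ[X])) :
    smythTheta ≤ intMahlerMeasure (X ^ (p + q) + C b * X ^ p + C (s * b) * X ^ q + C s : ℤ[X]) := by
  set g := Nat.gcd p q with hg
  have hg0 : 0 < g := Nat.gcd_pos_of_pos_left _ hp
  obtain ⟨p', hp'⟩ : g ∣ p := Nat.gcd_dvd_left p q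
  obtain ⟨q', hq'⟩ : g ∣ q := Nat.gcd_dvd_right p q
  have hp'0 : 0 < p' := by
    rcases Nat.eq_zero_or_pos p' with h | h
    · rw [h, mul_zero] at hp'; omega
    · exact h
  have hp'q' : p' < q' := by
    by_contra h; push Not at h
    have : q ≤ p := by rw [hp', hq']; exact Nat.mul_le_mul_left g h
    omega
  have hcop : Nat.Coprime p' q' := by
    have h := Nat.coprime_div_gcd_div_gcd (m := p) (n := q) hg0
    rw [← hg] at h
    have e1 : p / g = p' := by rw [hp', Nat.mul_div_cancel_left _ hg0]
    have e2 : q / g = q' := by rw [hq', Nat.mul_div_cancel_left _ hg0]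
    rwa [e1, e2] at h
  have hPR : (X ^ (p + q) + C b * X ^ p + C (s * b) * X ^ q + C s : ℤ[X]) =
      (X ^ (p' + q') + C b * X ^ p' + C (s * b) * X ^ q' + C s : ℤ[X]).comp (X ^ g) := by
    rw [← quadrinomial_eq_comp_X_pow, hp', hq', mul_comm g p', mul_comm g q']
  rw [hPR, intMahlerMeasure_comp_X_pow _ hg0] at hM ⊢
  exact smythTheta_le_measure_quadrinomial_coprime hp'0 hp'q' hcop hs hb0 hM

end Quadrinomial

/-- **Dobrowolski's Proposition 2 in the kernel.**  Every `P ∈ ℤ[X]` with at most four nonzero coefficients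
and `M(P) > 1` has `M(P) ≥ θ₀ = 1.3247…` (Smyth's constant; sharp for `x³ - x - 1` and
`x⁴ - x³ - x² + 1`).  [Dobrowolski2006, Prop. 2] — REPLICATION. -/
theorem smythTheta_le_measure_of_card_support_le_four (P : ℤ[X]) (hcard : P.support.card ≤ 4)
    (hM : 1 < intMahlerMeasure P) : smythTheta ≤ intMahlerMeasure P := by
  have hP0 : P ≠ 0 := by
    intro h; rw [h] at hM; unfold intMahlerMeasure at hM; simp at hM; linarith
  -- strip the power of `x`
  obtain ⟨P₀, hP₀, hndvd⟩ := exists_eq_pow_rootMultiplicity_mul_and_not_dvd P hP0 0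
  rw [map_zero, sub_zero] at hP₀ hndvd
  set j := P.rootMultiplicity 0 with hj
  have hc0 : P₀.coeff 0 ≠ 0 := fun h => hndvd (X_dvd_iff.mpr h)
  have hMeq : intMahlerMeasure P = intMahlerMeasure P₀ := by
    rw [hP₀, intMahlerMeasure_mul, intMahlerMeasure_X_pow, one_mul]
  have hcard₀ : P₀.support.card ≤ 4 := by rw [← card_support_X_pow_mul P₀ j, ← hP₀]; exact hcard
  rw [hMeq] at hM ⊢
  have hP₀0 : P₀ ≠ 0 := fun h => hc0 (by rw [h, coeff_zero])
  -- constants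
  rcases Nat.eq_zero_or_pos P₀.natDegree with hd0 | hdpos
  · rw [eq_C_of_natDegree_eq_zero hd0, intMahlerMeasure_C] at hM ⊢
    have : (2 : ℝ) ≤ |(P₀.coeff 0 : ℝ)| := by
      have h1' : (1 : ℤ) < |P₀.coeff 0| := by exact_mod_cast hM
      have : (2 : ℤ) ≤ |P₀.coeff 0| := h1'
      exact_mod_cast this
    linarith [smythTheta_lt]
  -- nonreciprocal: Smyth
  by_cases hrev : P₀.reverse = P₀ ∨ P₀.reverse = -P₀
  swap
  · obtain ⟨h1, h2⟩ := not_or.mp hrev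
    exact intMahlerMeasure_ge_smythTheta_of_nonreciprocal hc0 h1 h2
  -- leading coefficient `≥ 2`
  by_cases hlc : 2 ≤ |P₀.leadingCoeff|
  · have h := abs_leadingCoeff_le_intMahlerMeasure P₀
    have : (2 : ℝ) ≤ |(P₀.leadingCoeff : ℝ)| := by exact_mod_cast hlc
    linarith [smythTheta_lt]
  obtain ⟨ε, hε, hrel⟩ : ∃ ε : ℤ, (ε = 1 ∨ ε = -1) ∧
      ∀ i ≤ P₀.natDegree, P₀.coeff (P₀.natDegree - i) = ε * P₀.coeff i := by
    rcases hrev with h | h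
    · refine ⟨1, Or.inl rfl, fun i hi => ?_⟩
      have hc := congrArg (fun Q : ℤ[X] => Q.coeff i) h
      simp only [coeff_reverse, revAt_le hi] at hc
      rw [hc, one_mul]
    · refine ⟨-1, Or.inr rfl, fun i hi => ?_⟩
      have hc := congrArg (fun Q : ℤ[X] => Q.coeff i) h
      simp only [coeff_reverse, revAt_le hi, coeff_neg] at hc
      rw [hc]; ring
  have hlc1 : P₀.leadingCoeff = 1 ∨ P₀.leadingCoeff = -1 := by
    have hne : P₀.leadingCoeff ≠ 0 := leadingCoeff_ne_zero.mpr hP₀0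
    have hnn := abs_nonneg P₀.leadingCoeff
    rcases abs_choice P₀.leadingCoeff with h | h <;> rw [h] at hlc hnn <;> omega
  obtain ⟨Q, hQm, hQM, hQrel, hQcard, hQdeg⟩ : ∃ Q : ℤ[X], Q.Monic ∧ intMahlerMeasure Q = intMahlerMeasure P₀ ∧
      (∀ i ≤ Q.natDegree, Q.coeff (Q.natDegree - i) = ε * Q.coeff i) ∧ Q.support.card ≤ 4 ∧
      0 < Q.natDegree := by
    rcases hlc1 with h1 | h1
    · exact ⟨P₀, h1, rfl, hrel, hcard₀, hdpos⟩
    · refine ⟨-P₀, by rw [Monic, leadingCoeff_neg, h1, neg_neg], intMahlerMeasure_neg P₀, ?_,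
        by rwa [support_neg], by rwa [natDegree_neg]⟩
      intro i hi
      rw [natDegree_neg] at hi ⊢
      rw [coeff_neg, coeff_neg, hrel i hi]; ring
  rw [← hQM] at hM ⊢
  -- at most three monomials: `TrinomialSmythBound`
  by_cases hQ3 : Q.support.card ≤ 3
  · exact smythTheta_le_measure_of_card_support_le_three Q hQ3 hM
  have hQ4 : Q.support.card = 4 := by omega
  -- four monomials: the support is `{0, p, q, n}` with `q = n - p`
  set n := Q.natDegree with hn
  have hεε : ε * ε = 1 := by rcases hε with h | h <;> simp [h]
  have hε0 : ε ≠ 0 := by rcases hε with h | h <;> simp [h]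
  have hcn : Q.coeff n = 1 := hQm.coeff_natDegree
  have hq0 : Q.coeff 0 = ε := by
    have h := hQrel 0 (Nat.zero_le _)
    rw [Nat.sub_zero, hcn] at h
    linear_combination (-ε) * h + (-(Q.coeff 0)) * hεε
  set S := (Q.support.erase n).erase 0 with hS
  have hmemS : ∀ k, k ∈ S ↔ k ≠ 0 ∧ k ≠ n ∧ Q.coeff k ≠ 0 := by
    intro k; simp only [hS, Finset.mem_erase, mem_support_iff]
  have hScard : S.card = 2 := by
    have h1 : n ∈ Q.support := mem_support_iff.mpr (by rw [hcn]; exact one_ne_zero)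
    have h2 : 0 ∈ Q.support.erase n := Finset.mem_erase.mpr ⟨by omega, mem_support_iff.mpr (by rw [hq0]; exact hε0)⟩
    have e1 : S.card = (Q.support.erase n).card - 1 := Finset.card_erase_of_mem h2
    have e2 : (Q.support.erase n).card = Q.support.card - 1 := Finset.card_erase_of_mem h1
    omega
  have hzero : ∀ k, k ∉ S → k ≠ 0 → k ≠ n → Q.coeff k = 0 := by
    intro k hk hk0 hkn
    by_contra h
    exact hk ((hmemS k).mpr ⟨hk0, hkn, h⟩)
  have hsymm : ∀ k ∈ S, n - k ∈ S := by
    intro k hk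
    obtain ⟨hk0, hkn, hkc⟩ := (hmemS k).mp hk
    have hkle : k ≤ n := le_natDegree_of_ne_zero hkc
    refine (hmemS _).mpr ⟨by omega, by omega, ?_⟩
    rw [hQrel k hkle]
    exact mul_ne_zero hε0 hkc
  obtain ⟨i, j', hij, hSij⟩ := Finset.card_eq_two.mp hScard
  wlog hlt : i < j' generalizing i j'
  · exact this j' i hij.symm (by rw [hSij, Finset.pair_comm]) (by omega)
  have hiS : i ∈ S := by rw [hSij]; simp
  have hjS : j' ∈ S := by rw [hSij]; simp
  obtain ⟨hi0, hin, hic⟩ := (hmemS i).mp hiS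
  obtain ⟨hj0, hjn, hjc⟩ := (hmemS j').mp hjS
  have hile : i ≤ n := le_natDegree_of_ne_zero hic
  have hjle : j' ≤ n := le_natDegree_of_ne_zero hjc
  have h1 := hsymm i hiS
  have h2' := hsymm j' hjS
  rw [hSij, Finset.mem_insert, Finset.mem_singleton] at h1 h2'
  have hnij : n = i + j' := by omega
  have hipos : 0 < i := Nat.pos_of_ne_zero hi0
  set b := Q.coeff i with hb
  have hcj : Q.coeff j' = ε * b := by
    have h := hQrel i hile
    rwa [show n - i = j' by omega] at h
  have hQ : Q = X ^ (i + j') + C b * X ^ i + C (ε * b) * X ^ j' + C ε := by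
    ext k
    simp only [coeff_add, coeff_X_pow, coeff_C_mul, coeff_C]
    by_cases hk0 : k = 0
    · subst hk0
      rw [if_neg (by omega), if_neg (by omega), if_neg (by omega), if_pos rfl, hq0]; ring
    by_cases hkn : k = i + j'
    · subst hkn
      rw [if_pos rfl, if_neg (by omega), if_neg (by omega), if_neg (by omega), ← hnij, hcn]; ring
    by_cases hki : k = i
    · subst hki
      rw [if_neg hkn, if_pos rfl, if_neg (by omega), if_neg hk0]; ring
    by_cases hkj : k = j'
    · subst hkj
      rw [if_neg hkn, if_neg (by omega), if_pos rfl, if_neg hk0, hcj]; ring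
    rw [if_neg hkn, if_neg hki, if_neg hkj, if_neg hk0]
    have : k ∉ S := by rw [hSij, Finset.mem_insert, Finset.mem_singleton]; exact not_or.mpr ⟨hki, hkj⟩
    rw [hzero k this hk0 (by omega)]; ring
  rw [hQ] at hM ⊢
  exact smythTheta_le_measure_quadrinomial hipos hlt hε hic hM

/-- **Corollary (the measure dichotomy for sparse polynomials).**  Every `P ∈ ℤ[X]` with at most four
monomials has `M(P) ≤ 1` or `M(P) ≥ θ₀`. -/
theorem measure_dichotomy_of_card_support_le_four (P : ℤ[X]) (hcard : P.support.card ≤ 4) :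
    intMahlerMeasure P ≤ 1 ∨ smythTheta ≤ intMahlerMeasure P := by
  by_cases h : 1 < intMahlerMeasure P
  · exact Or.inr (smythTheta_le_measure_of_card_support_le_four P hcard h)
  · exact Or.inl (not_lt.mp h)

/-- **Sharpness witness among quadrinomials** ([Dobrowolski2006, §7]): `x⁴ - x³ - x² + 1 = (x - 1)(x³ - x - 1)` has exactly four
monomials and Mahler measure `θ₀`. -/
theorem intMahlerMeasure_quadrinomial_sharp :
    (X ^ 4 - X ^ 3 - X ^ 2 + 1 : ℤ[X]).support.card = 4 ∧
      intMahlerMeasure (X ^ 4 - X ^ 3 - X ^ 2 + 1 : ℤ[X]) = smythTheta := by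
  constructor
  · have h : (X ^ 4 - X ^ 3 - X ^ 2 + 1 : ℤ[X]).support = {0, 2, 3, 4} := by
      ext k
      simp only [mem_support_iff, coeff_add, coeff_sub, coeff_X_pow, coeff_one, Finset.mem_insert,
        Finset.mem_singleton]
      constructor
      · intro hk
        by_contra hnot
        push Not at hnot
        obtain ⟨h0, h2, h3, h4⟩ := hnot
        apply hk
        rw [if_neg h4, if_neg h3, if_neg h2, if_neg h0]; ring
      · rintro (rfl | rfl | rfl | rfl) <;> norm_num
    rw [h]; rfl
  · have hfac : (X ^ 4 - X ^ 3 - X ^ 2 + 1 : ℤ[X]) = (X ^ 1 + C (-1)) * (X ^ 3 - X - 1) := by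
      rw [map_neg, map_one]; ring
    rw [hfac, intMahlerMeasure_mul, intMahlerMeasure_X_pow_add_sign (Or.inr rfl) one_pos, one_mul,
      intMahlerMeasure_X_cube_sub_X_sub_one]

/-- **Discharge of the Literature named fact** `QuadrinomialMahlerBound` ([Dobrowolski2006, Prop. 2] as
filed in `Literature/NumberTheory/MahlerMeasure/FewMonomials.lean`): a monic `f ∈ ℤ[x]`, `f(0) ≠ 0`, with
exactly four nonzero coefficients, not a product of cyclotomic polynomials, has `M(x³ - x - 1) ≤ M(f)`
(Kronecker's theorem turns "not a product of cyclotomics" into `M(f) > 1`). -/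
theorem quadrinomialMahlerBound_holds : Literature.NumberTheory.MahlerMeasure.QuadrinomialMahlerBound := by
  intro f hmon h0 hcard hncyc
  change intMahlerMeasure (X ^ 3 - X - 1 : ℤ[X]) ≤ intMahlerMeasure f
  rw [intMahlerMeasure_X_cube_sub_X_sub_one]
  have hf0 : f ≠ 0 := hmon.ne_zero
  rcases (one_le_intMahlerMeasure hf0).lt_or_eq with hlt | heq
  · exact smythTheta_le_measure_of_card_support_le_four f hcard.le hlt
  exfalso
  obtain ⟨u, a, t, hu, -, hf⟩ := kronecker_form heq.symm
  have ha : a = 0 := by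
    by_contra ha
    apply h0
    rw [hf, coeff_zero_eq_eval_zero, eval_mul, eval_mul, eval_pow, eval_X, zero_pow ha, mul_zero, zero_mul]
  have hu1 : u = 1 := by
    have hl : f.leadingCoeff = 1 := hmon
    rwa [hf, ha, pow_zero, mul_one, leadingCoeff_mul, leadingCoeff_C, (monic_cyclotomic_prod t).leadingCoeff,
      mul_one] at hl
  exact hncyc t (by rw [hf, ha, hu1, pow_zero, mul_one, C_1, one_mul])

end Summit.Ventures.DiscreteObjects.Mahler
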